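import Literature.MathematicalPhysics.QuantumManyBody.LeeHuangYangRiemannSum
import Mathlib.Analysis.SpecialFunctions.Trigonometric.DerivHyp
import HarnessLib

/-!
# The Bogoliubov coefficients `σ_p = sinh ν_p`, `γ_p = cosh ν_p` (`tanh 2ν_p = -μ/(p²+μ)`):
# closed forms (2.13), pointwise bounds (2.14)–(2.15) and the lattice norms of Lemma 2.2

Topic `Literature/MathematicalPhysics/QuantumManyBody`, proofs-only companion of
`LeeHuangYangRiemannSum.lean` (whose lattice-point counting it reuses), written for the provefact
`Literature.MathematicalPhysics.QuantumManyBody.BoseGas.BastiCenatiempoSchlein2021_upperBound`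
(= `BCS2021_lhyUpperBound_dirichlet`, [BastiCenatiempoSchlein2021, Thm. 1.1]); a second
design-independent brick of the trial state of [BastiCenatiempoSchlein2021, Prop. 1.3, §2].

Source, [BastiCenatiempoSchlein2021, §2, pp. 7–8 of arXiv:2101.06222]: the Bogoliubov transformation
`T_ν = exp(½∑ ν_p(a*_p a*_{-p} - a_p a_{-p}))` uses on the low momenta the angles `τ_p` with
(2.12) `tanh(2τ_p) = -8π𝔞N^κ/(p² + 8π𝔞N^κ)`, and `γ_p = cosh ν_p`, `σ_p = sinh ν_p`; the proof of
Lemma 2.2 records (2.13)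
`σ_p² = (p² + 8π𝔞N^κ - √(|p|⁴ + 16π𝔞N^κp²))/(2√(|p|⁴ + 16π𝔞N^κp²))`,
`σ_pγ_p = -8π𝔞N^κ/(2√(|p|⁴ + 16π𝔞N^κp²))`, the pointwise bounds (2.14)
`σ_p² ≤ C N^{κ/2}/|p|` (`|p| ≤ N^{κ/2}`), `σ_p² ≤ C N^{2κ}/|p|⁴` (`|p| ≥ N^{κ/2}`), and sums them over
`P_L = {p ∈ 2πℤ³∖0 : |p| ≤ N^{κ/2+ε}}`: **Lemma 2.2** (σ/γ part) `‖γ_L‖²_∞, ‖σ_L‖²_∞ ≤ CN^{κ/2}`,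
`‖γ_Lσ_L‖₁ ≤ CN^{3κ/2+ε}`, `‖γ_L‖² ≤ CN^{3κ/2+3ε}`, `‖σ_L‖² ≤ CN^{3κ/2}`, `‖σ_L‖²_{H¹} ≤ CN^{5κ/2+ε}`,
`‖σ_S‖² ≤ CN^{3κ/2}`, `‖σ_S‖²_{H¹} ≤ CN^{5κ/2+ε}`, `‖γ_S‖²_∞, ‖σ_S‖²_∞ ≤ CN^ε`.

This file PROVES these statements in closed form, with `μ` for `8π𝔞N^κ` (any `μ > 0`), a lattice
`hℤ³` of arbitrary spacing `h > 0` (`latticeVec h n`; the paper has `h = 2π`, `N^{κ/2} ≍ √μ`) and a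
cut-off `P` for `N^{κ/2+ε}`, with explicit absolute constants and for arbitrary finite index sets
(no summability bookkeeping):

* **The angle.** `tanh_two_mul_bogoliubovAngle` (the solution `ν = ¼log((A-B)/(A+B))` of
  `tanh 2ν = -B/A`, `|B| < A`), `cosh_two_mul_of_tanh`, `sinh_two_mul_of_tanh`, `sinh_sq_of_tanh`
  (**(2.13)**: `sinh²ν = (A-D)/(2D)`, `sinh ν cosh ν = -B/(2D)`, `D = √(A²-B²)`), `cosh_sq_of_tanh`,
  `bogoliubov_discriminant` (`(p²+μ)² - μ² = p⁴ + 2μp²`).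
* **Pointwise (2.14)–(2.15)**, `s = √(r⁴+2μr²)`, `r = |p| > 0`: `sigmaSq_eq`
  (`σ² = μ²/(2s(r²+μ+s))`), `sigmaSq_nonneg`, `sigmaSq_le_sqrt_div` (`σ² ≤ √μ/(2√2r)`, all `r`),
  `sigmaSq_le_sq_div_pow_four` (`σ² ≤ μ²/(4r⁴)`, all `r`), `gammaSigma_le_sqrt_div`
  (`μ/(2s) ≤ √μ/(2√2r)`), `gammaSigma_le_div_sq` (`μ/(2s) ≤ μ/(2r²)`).
* **Lattice sums over `hℤ³ ∖ 0`** (dyadic shells `h4ᵏ ≤ |p| < h4ᵏ⁺¹` and the point count of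
  `LeeHuangYangRiemannSum.card_filter_norm_latticeVec_lt_le`): `latticeSum_inv_norm_le`
  (`∑_{|p|<R}|p|⁻¹ ≤ 778R²/h³`), `latticeSum_inv_norm_sq_le` (`∑_{|p|<R}|p|⁻² ≤ 972R/h³`),
  `latticeSum_inv_norm_pow_four_le` (`∑_{|p|≥R}|p|⁻⁴ ≤ 972/(Rh³)`, `R ≥ h`),
  `card_filter_norm_latticeVec_le_le` (`#{|p| ≤ P} ≤ (2P/h+3)³`); the finite geometric sums
  `sum_four_pow_le`, `sum_sixteen_pow_le`, `sum_inv_four_pow_le`.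
* **Lemma 2.2 (σ/γ part)** for `0 < h ≤ √μ ≤ P`, sums over any finite set of non-zero momenta
  (with `|p| ≤ P` where stated): `latticeSum_sigmaSq_le` (`∑σ² ≤ 520μ^{3/2}/h³`, no cut-off needed),
  `latticeSum_gammaSigma_le` (`∑μ/(2s) ≤ (276μ^{3/2} + 972μP)/h³`), `latticeSum_sq_mul_sigmaSq_le`
  (`∑|p|²σ² ≤ (10μ^{5/2} + 486μ²P)/h³`), `latticeSum_one_add_sigmaSq_le`
  (`∑(1+σ²) ≤ (2P/h+3)³ + 520μ^{3/2}/h³`), `sigmaSq_latticeVec_le_of_le` (sup bounds on `|p| ≥ R₁`).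
  With `h = 2π`, `μ = 8π𝔞N^κ`, `P = N^{κ/2+ε}`, `R₁ = N^{κ/2-ε}` these are the printed powers of `N`.

The `η`-part of Lemma 2.2 (`‖η_{L^c}‖`, `‖η_H‖`, …) depends on the Neumann scattering problem of
Lemma 2.1 and is not treated here. No definitions, no named facts.

## References

* [BastiCenatiempoSchlein2021] G. Basti, S. Cenatiempo, B. Schlein, *A new second-order upper bound
  for the ground state energy of dilute Bose gases*, Forum Math. Sigma 9 (2021) e74
  (arXiv:2101.06222): §2, (2.12)–(2.16) and Lemma 2.2 with its proof (pp. 7–8).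
* [LSSY2005] E. H. Lieb, R. Seiringer, J. P. Solovej, J. Yngvason, *The Mathematics of the Bose Gas
  and its Condensation* (2005), App. A, (A.18)–(A.21) (the Bogoliubov transformation
  `b_p = (a_p + α_p a*_{-p})/√(1-α_p²)`).
-/

noncomputable section

open MeasureTheory Set Filter Topology Metric
open scoped ENNReal NNReal

namespace Literature.MathematicalPhysics.QuantumManyBody.BoseGas

/-! ### The Bogoliubov angle: `tanh(2ν) = -B/A` -/

/-- **Existence of the Bogoliubov angle.** For `|B| < A` the equation `tanh(2ν) = -B/A` has the
solution `ν = ¼ log((A - B)/(A + B))`. [cite: BastiCenatiempoSchlein2021, (2.12)] -/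
theorem tanh_two_mul_bogoliubovAngle {A B : ℝ} (hAB : |B| < A) :
    Real.tanh (2 * (1 / 4 * Real.log ((A - B) / (A + B)))) = -B / A := by
  have hB := abs_lt.1 hAB
  have h1 : 0 < A - B := by linarith
  have h2 : 0 < A + B := by linarith
  have hA : 0 < A := by linarith
  set q := (A - B) / (A + B) with hq
  have hq0 : 0 < q := div_pos h1 h2
  have hx : 2 * (1 / 4 * Real.log q) = Real.log q / 2 := by ring
  rw [hx, Real.tanh_eq_sinh_div_cosh, Real.sinh_eq, Real.cosh_eq]
  have he : Real.exp (Real.log q / 2) = Real.sqrt q := by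
    rw [Real.sqrt_eq_rpow, Real.rpow_def_of_pos hq0]; ring_nf
  have he' : Real.exp (-(Real.log q / 2)) = (Real.sqrt q)⁻¹ := by
    rw [Real.exp_neg, he]
  rw [he, he']
  have hsq : 0 < Real.sqrt q := Real.sqrt_pos.2 hq0
  have hsq2 : Real.sqrt q ^ 2 = q := Real.sq_sqrt hq0.le
  rw [div_div_div_cancel_right₀ (two_ne_zero), div_eq_div_iff (by positivity) hA.ne']
  field_simp
  rw [hsq2, hq]
  field_simp
  ring

/-- **`cosh(2ν) = A/√(A²-B²)`** when `tanh(2ν) = -B/A`, `|B| < A`. [folklore] -/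
theorem cosh_two_mul_of_tanh {A B ν : ℝ} (hAB : |B| < A) (h : Real.tanh (2 * ν) = -B / A) :
    Real.cosh (2 * ν) = A / Real.sqrt (A ^ 2 - B ^ 2) := by
  have hB := abs_lt.1 hAB
  have hA : 0 < A := by linarith
  have hD2 : 0 < A ^ 2 - B ^ 2 := by nlinarith
  have hD : 0 < Real.sqrt (A ^ 2 - B ^ 2) := Real.sqrt_pos.2 hD2
  have hc : 0 < Real.cosh (2 * ν) := Real.cosh_pos _
  have hs : Real.sinh (2 * ν) = -B / A * Real.cosh (2 * ν) := by
    rw [Real.tanh_eq_sinh_div_cosh, div_eq_iff hc.ne'] at h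
    exact h
  have hid := Real.cosh_sq_sub_sinh_sq (2 * ν)
  rw [hs] at hid
  -- `cosh² (1 - B²/A²) = 1`
  have hc2 : Real.cosh (2 * ν) ^ 2 = A ^ 2 / (A ^ 2 - B ^ 2) := by
    rw [eq_div_iff hD2.ne']
    field_simp at hid
    nlinarith [hid]
  have : Real.cosh (2 * ν) = Real.sqrt (A ^ 2 / (A ^ 2 - B ^ 2)) := by
    rw [← hc2, Real.sqrt_sq hc.le]
  rw [this, Real.sqrt_div' _ hD2.le, Real.sqrt_sq hA.le]

/-- **`sinh(2ν) = -B/√(A²-B²)`** when `tanh(2ν) = -B/A`, `|B| < A`. [folklore] -/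
theorem sinh_two_mul_of_tanh {A B ν : ℝ} (hAB : |B| < A) (h : Real.tanh (2 * ν) = -B / A) :
    Real.sinh (2 * ν) = -B / Real.sqrt (A ^ 2 - B ^ 2) := by
  have hB := abs_lt.1 hAB
  have hA : 0 < A := by linarith
  have hc : 0 < Real.cosh (2 * ν) := Real.cosh_pos _
  have hs : Real.sinh (2 * ν) = -B / A * Real.cosh (2 * ν) := by
    rw [Real.tanh_eq_sinh_div_cosh, div_eq_iff hc.ne'] at h
    exact h
  rw [hs, cosh_two_mul_of_tanh hAB h]
  field_simp

/-- **The Bogoliubov coefficients (2.13).** If `tanh(2ν) = -B/A` with `|B| < A`, then with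
`D = √(A²-B²)`: `sinh²ν = (A - D)/(2D)` and `sinh ν cosh ν = -B/(2D)`; for
`A = p² + 8π𝔞N^κ`, `B = 8π𝔞N^κ` this is
`σ_p² = (p² + 8π𝔞N^κ - √(p⁴+16π𝔞N^κp²))/(2√(p⁴+16π𝔞N^κp²))`,
`γ_pσ_p = -8π𝔞N^κ/(2√(p⁴+16π𝔞N^κp²))`. [cite: BastiCenatiempoSchlein2021, (2.12)–(2.13)] -/
theorem sinh_sq_of_tanh {A B ν : ℝ} (hAB : |B| < A) (h : Real.tanh (2 * ν) = -B / A) :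
    Real.sinh ν ^ 2 = (A - Real.sqrt (A ^ 2 - B ^ 2)) / (2 * Real.sqrt (A ^ 2 - B ^ 2)) ∧
      Real.sinh ν * Real.cosh ν = -B / (2 * Real.sqrt (A ^ 2 - B ^ 2)) := by
  have hB := abs_lt.1 hAB
  have hD2 : 0 < A ^ 2 - B ^ 2 := by nlinarith
  have hD : 0 < Real.sqrt (A ^ 2 - B ^ 2) := Real.sqrt_pos.2 hD2
  have hc2 := cosh_two_mul_of_tanh hAB h
  have hs2 := sinh_two_mul_of_tanh hAB h
  rw [Real.cosh_two_mul] at hc2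
  rw [Real.sinh_two_mul] at hs2
  have hid := Real.cosh_sq_sub_sinh_sq ν
  constructor
  · -- `2 sinh² = cosh 2ν - 1`
    have : Real.sinh ν ^ 2 = (A / Real.sqrt (A ^ 2 - B ^ 2) - 1) / 2 := by linarith
    rw [this]
    field_simp
  · have : Real.sinh ν * Real.cosh ν = (-B / Real.sqrt (A ^ 2 - B ^ 2)) / 2 := by linarith
    rw [this]
    field_simp

/-- `cosh²ν = 1 + sinh²ν = (A + D)/(2D)`. [cite: BastiCenatiempoSchlein2021, (2.13)] -/
theorem cosh_sq_of_tanh {A B ν : ℝ} (hAB : |B| < A) (h : Real.tanh (2 * ν) = -B / A) :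
    Real.cosh ν ^ 2 = (A + Real.sqrt (A ^ 2 - B ^ 2)) / (2 * Real.sqrt (A ^ 2 - B ^ 2)) := by
  have hB := abs_lt.1 hAB
  have hD2 : 0 < A ^ 2 - B ^ 2 := by nlinarith
  have hD : 0 < Real.sqrt (A ^ 2 - B ^ 2) := Real.sqrt_pos.2 hD2
  have h1 := (sinh_sq_of_tanh hAB h).1
  have hid := Real.cosh_sq_sub_sinh_sq ν
  have : Real.cosh ν ^ 2 = 1 + Real.sinh ν ^ 2 := by linarith
  rw [this, h1]
  field_simp
  ring

/-- For the momentum coefficients: `(p²+μ)² - μ² = p⁴ + 2μp²`, so `D = √(p⁴+2μp²)`, and `|μ| < p² + μ`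
for `p ≠ 0`, `μ > 0`. [cite: BastiCenatiempoSchlein2021, (2.12)–(2.13)] -/
theorem bogoliubov_discriminant (μ r : ℝ) : (r ^ 2 + μ) ^ 2 - μ ^ 2 = r ^ 4 + 2 * μ * r ^ 2 := by ring

/-! ### Pointwise bounds on `σ_p² = (p²+μ-s)/(2s)` and `γ_pσ_p = -μ/(2s)`, `s = √(p⁴+2μp²)` -/

/-- `√(2μ)·r ≤ √(r⁴+2μr²)` (`r, μ ≥ 0`). [folklore] -/
theorem sqrt_two_mul_mul_le_sqrt {μ r : ℝ} (hμ : 0 ≤ μ) (hr : 0 ≤ r) :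
    Real.sqrt (2 * μ) * r ≤ Real.sqrt (r ^ 4 + 2 * μ * r ^ 2) := by
  have h1 : Real.sqrt (2 * μ * r ^ 2) = Real.sqrt (2 * μ) * r := by
    rw [Real.sqrt_mul (by positivity : (0 : ℝ) ≤ 2 * μ) (r ^ 2), Real.sqrt_sq hr]
  rw [← h1]
  exact Real.sqrt_le_sqrt (by nlinarith [pow_nonneg hr 4])

/-- **Exact form of `σ²`**: `(r²+μ-s)/(2s) = μ²/(2s(r²+μ+s))`, `s = √(r⁴+2μr²)` (`r > 0`, `μ ≥ 0`),
from `(r²+μ)² - s² = μ²`. [cite: BastiCenatiempoSchlein2021, (2.13)] -/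
theorem sigmaSq_eq {μ r : ℝ} (hμ : 0 ≤ μ) (hr : 0 < r) :
    (r ^ 2 + μ - Real.sqrt (r ^ 4 + 2 * μ * r ^ 2)) / (2 * Real.sqrt (r ^ 4 + 2 * μ * r ^ 2)) =
      μ ^ 2 / (2 * Real.sqrt (r ^ 4 + 2 * μ * r ^ 2) *
        (r ^ 2 + μ + Real.sqrt (r ^ 4 + 2 * μ * r ^ 2))) := by
  set s := Real.sqrt (r ^ 4 + 2 * μ * r ^ 2) with hs
  have hs2 : s ^ 2 = r ^ 4 + 2 * μ * r ^ 2 := Real.sq_sqrt (by positivity)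
  have hs0 : 0 < s := by
    rw [hs]; exact Real.sqrt_pos.2 (by positivity)
  rw [div_eq_div_iff (by positivity) (by positivity)]
  nlinarith [hs2]

/-- **`σ² ≥ 0`.** [cite: BastiCenatiempoSchlein2021, (2.13)] -/
theorem sigmaSq_nonneg {μ r : ℝ} (hμ : 0 ≤ μ) (hr : 0 < r) :
    0 ≤ (r ^ 2 + μ - Real.sqrt (r ^ 4 + 2 * μ * r ^ 2)) / (2 * Real.sqrt (r ^ 4 + 2 * μ * r ^ 2)) := by
  rw [sigmaSq_eq hμ hr]; positivity

/-- **`σ_p² ≤ √μ/(2√2 |p|)`** for all `p ≠ 0` (the bound "`σ_p² ≤ CN^{κ/2}/|p|`" of (2.14), here without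
restriction on `|p|`): from `s ≥ √(2μ)|p|` and `|p|² + μ + s ≥ μ`.
[cite: BastiCenatiempoSchlein2021, (2.14)] -/
theorem sigmaSq_le_sqrt_div {μ r : ℝ} (hμ : 0 < μ) (hr : 0 < r) :
    (r ^ 2 + μ - Real.sqrt (r ^ 4 + 2 * μ * r ^ 2)) / (2 * Real.sqrt (r ^ 4 + 2 * μ * r ^ 2)) ≤
      Real.sqrt μ / (2 * Real.sqrt 2 * r) := by
  rw [sigmaSq_eq hμ.le hr]
  set s := Real.sqrt (r ^ 4 + 2 * μ * r ^ 2) with hs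
  have hs0 : 0 < s := by rw [hs]; exact Real.sqrt_pos.2 (by positivity)
  have hsl : Real.sqrt (2 * μ) * r ≤ s := sqrt_two_mul_mul_le_sqrt hμ.le hr.le
  have h2μ : Real.sqrt (2 * μ) = Real.sqrt 2 * Real.sqrt μ := Real.sqrt_mul (by norm_num) μ
  have hsμ : 0 < Real.sqrt μ := Real.sqrt_pos.2 hμ
  have hsμ2 : Real.sqrt μ ^ 2 = μ := Real.sq_sqrt hμ.le
  have hs2' : 0 < Real.sqrt 2 := Real.sqrt_pos.2 (by norm_num)
  rw [h2μ] at hsl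
  have hr2 : r ^ 2 + μ + s ≥ μ := by nlinarith [hs0.le, sq_nonneg r]
  calc μ ^ 2 / (2 * s * (r ^ 2 + μ + s)) ≤ μ ^ 2 / (2 * (Real.sqrt 2 * Real.sqrt μ * r) * μ) := by
        apply div_le_div_of_nonneg_left (by positivity) (by positivity)
        gcongr
    _ = Real.sqrt μ / (2 * Real.sqrt 2 * r) := by
        field_simp
        nlinarith [hsμ2]

/-- **`σ_p² ≤ μ²/(4|p|⁴)`** for all `p ≠ 0` (the bound "`σ_p² ≤ CN^{2κ}/|p|⁴`" of (2.14)): from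
`s ≥ |p|²`. [cite: BastiCenatiempoSchlein2021, (2.14)] -/
theorem sigmaSq_le_sq_div_pow_four {μ r : ℝ} (hμ : 0 ≤ μ) (hr : 0 < r) :
    (r ^ 2 + μ - Real.sqrt (r ^ 4 + 2 * μ * r ^ 2)) / (2 * Real.sqrt (r ^ 4 + 2 * μ * r ^ 2)) ≤
      μ ^ 2 / (4 * r ^ 4) := by
  rw [sigmaSq_eq hμ hr]
  set s := Real.sqrt (r ^ 4 + 2 * μ * r ^ 2) with hs
  have hs1 : r ^ 2 ≤ s := sq_le_sqrt_pow_four_add hμ r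
  have hr4 : 0 < r ^ 4 := by positivity
  apply div_le_div_of_nonneg_left (by positivity) (by positivity)
  nlinarith [hs1, sq_nonneg r]

/-- **`|γ_pσ_p| = μ/(2s) ≤ √μ/(2√2|p|)`** (`p ≠ 0`, `μ > 0`). [cite: BastiCenatiempoSchlein2021, (2.13)–(2.14)] -/
theorem gammaSigma_le_sqrt_div {μ r : ℝ} (hμ : 0 < μ) (hr : 0 < r) :
    μ / (2 * Real.sqrt (r ^ 4 + 2 * μ * r ^ 2)) ≤ Real.sqrt μ / (2 * Real.sqrt 2 * r) := by
  have hsl : Real.sqrt (2 * μ) * r ≤ Real.sqrt (r ^ 4 + 2 * μ * r ^ 2) :=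
    sqrt_two_mul_mul_le_sqrt hμ.le hr.le
  have h2μ : Real.sqrt (2 * μ) = Real.sqrt 2 * Real.sqrt μ := Real.sqrt_mul (by norm_num) μ
  have hsμ : 0 < Real.sqrt μ := Real.sqrt_pos.2 hμ
  have hsμ2 : Real.sqrt μ ^ 2 = μ := Real.sq_sqrt hμ.le
  have hs2' : 0 < Real.sqrt 2 := Real.sqrt_pos.2 (by norm_num)
  rw [h2μ] at hsl
  calc μ / (2 * Real.sqrt (r ^ 4 + 2 * μ * r ^ 2)) ≤ μ / (2 * (Real.sqrt 2 * Real.sqrt μ * r)) := by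
        apply div_le_div_of_nonneg_left hμ.le (by positivity)
        gcongr
    _ = Real.sqrt μ / (2 * Real.sqrt 2 * r) := by
        field_simp
        nlinarith [hsμ2]

/-- **`|γ_pσ_p| = μ/(2s) ≤ μ/(2|p|²)`** (`p ≠ 0`, `μ ≥ 0`). [cite: BastiCenatiempoSchlein2021, (2.13)–(2.14)] -/
theorem gammaSigma_le_div_sq {μ r : ℝ} (hμ : 0 ≤ μ) (hr : 0 < r) :
    μ / (2 * Real.sqrt (r ^ 4 + 2 * μ * r ^ 2)) ≤ μ / (2 * r ^ 2) := by
  apply div_le_div_of_nonneg_left hμ (by positivity)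
  have := sq_le_sqrt_pow_four_add hμ r
  linarith

/-! ### Finite geometric sums over arbitrary finite sets of shell indices -/

/-- `∑_{k ∈ T} 4ᵏ ≤ (4/3)M` if `4ᵏ ≤ M` for all `k ∈ T`. [folklore] -/
theorem sum_four_pow_le {T : Finset ℕ} {M : ℝ} (hM : 0 ≤ M) (hT : ∀ k ∈ T, (4 : ℝ) ^ k ≤ M) :
    ∑ k ∈ T, (4 : ℝ) ^ k ≤ 4 / 3 * M := by
  rcases T.eq_empty_or_nonempty with hT0 | hT0
  · rw [hT0, Finset.sum_empty]; positivity
  · set K := T.max' hT0 with hK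
    have hsub : T ⊆ Finset.range (K + 1) := fun k hk =>
      Finset.mem_range.2 (Nat.lt_succ_of_le (T.le_max' k hk))
    have hKM : (4 : ℝ) ^ K ≤ M := hT K (T.max'_mem hT0)
    calc ∑ k ∈ T, (4 : ℝ) ^ k ≤ ∑ k ∈ Finset.range (K + 1), (4 : ℝ) ^ k :=
          Finset.sum_le_sum_of_subset_of_nonneg hsub fun k _ _ => by positivity
      _ = (4 ^ (K + 1) - 1) / (4 - 1) := geom_sum_eq (by norm_num) (K + 1)
      _ ≤ 4 / 3 * 4 ^ K := by rw [pow_succ]; norm_num; nlinarith [pow_pos (by norm_num : (0:ℝ) < 4) K]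
      _ ≤ 4 / 3 * M := by gcongr

/-- `∑_{k ∈ T} 16ᵏ ≤ (16/15)M²` if `4ᵏ ≤ M` for all `k ∈ T`. [folklore] -/
theorem sum_sixteen_pow_le {T : Finset ℕ} {M : ℝ} (hT : ∀ k ∈ T, (4 : ℝ) ^ k ≤ M) :
    ∑ k ∈ T, (16 : ℝ) ^ k ≤ 16 / 15 * M ^ 2 := by
  rcases T.eq_empty_or_nonempty with hT0 | hT0
  · rw [hT0, Finset.sum_empty]; positivity
  · set K := T.max' hT0 with hK
    have hsub : T ⊆ Finset.range (K + 1) := fun k hk =>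
      Finset.mem_range.2 (Nat.lt_succ_of_le (T.le_max' k hk))
    have hKM : (4 : ℝ) ^ K ≤ M := hT K (T.max'_mem hT0)
    have h16 : (16 : ℝ) ^ K = ((4 : ℝ) ^ K) ^ 2 := by
      rw [← pow_mul, mul_comm, pow_mul]; norm_num
    calc ∑ k ∈ T, (16 : ℝ) ^ k ≤ ∑ k ∈ Finset.range (K + 1), (16 : ℝ) ^ k :=
          Finset.sum_le_sum_of_subset_of_nonneg hsub fun k _ _ => by positivity
      _ = (16 ^ (K + 1) - 1) / (16 - 1) := geom_sum_eq (by norm_num) (K + 1)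
      _ ≤ 16 / 15 * 16 ^ K := by rw [pow_succ]; norm_num; nlinarith [pow_pos (by norm_num : (0:ℝ) < 16) K]
      _ = 16 / 15 * ((4 : ℝ) ^ K) ^ 2 := by rw [h16]
      _ ≤ 16 / 15 * M ^ 2 := by gcongr

/-- `∑_{k ∈ T} 4⁻ᵏ ≤ 4/3`. [folklore] -/
theorem sum_inv_four_pow_le (T : Finset ℕ) : ∑ k ∈ T, ((1 : ℝ) / 4) ^ k ≤ 4 / 3 := by
  have hs : Summable (fun k : ℕ => ((1 : ℝ) / 4) ^ k) :=
    summable_geometric_of_lt_one (by norm_num) (by norm_num)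
  calc ∑ k ∈ T, ((1 : ℝ) / 4) ^ k ≤ ∑' k : ℕ, ((1 : ℝ) / 4) ^ k :=
        hs.sum_le_tsum _ (fun k _ => by positivity)
    _ = 4 / 3 := by rw [tsum_geometric_of_lt_one (by norm_num) (by norm_num)]; norm_num

/-! ### Lattice sums over `hℤ³ ∖ 0`: `∑_{|p|<R} |p|⁻¹`, `∑_{|p|<R} |p|⁻²`, `∑_{|p|≥R} |p|⁻⁴` -/

/-- The shells from `h`: for `n ≠ 0` (so `‖h·n‖ ≥ h`), `k(n) = log₄⌊‖h·n‖/h⌋` satisfies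
`h4ᵏ ≤ ‖h·n‖ < h4ᵏ⁺¹`, the shell has at most `729·64ᵏ` points of any finite `S`, and `4ᵏ < R/h` if
`‖h·n‖ < R`. [folklore] -/
theorem card_shell_le {h : ℝ} (hh : 0 < h) (S : Finset (Fin 3 → ℤ)) (k : ℕ) :
    ((S.filter fun n => Nat.log 4 ⌊‖latticeVec h n‖ / h⌋₊ = k ∧ h ≤ ‖latticeVec h n‖).card : ℝ) ≤
      729 * 64 ^ k := by
  have hsub : (S.filter fun n => Nat.log 4 ⌊‖latticeVec h n‖ / h⌋₊ = k ∧ h ≤ ‖latticeVec h n‖) ⊆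
      S.filter (fun n => ‖latticeVec h n‖ < h * 4 ^ (k + 1)) := by
    intro n hn
    rw [Finset.mem_filter] at hn ⊢
    obtain ⟨hnS, hnk, hnh⟩ := hn
    have hb := (shell_bounds hh hnh).2
    rw [hnk] at hb
    exact ⟨hnS, hb⟩
  calc ((S.filter fun n => Nat.log 4 ⌊‖latticeVec h n‖ / h⌋₊ = k ∧ h ≤ ‖latticeVec h n‖).card : ℝ)
      ≤ ((S.filter (fun n => ‖latticeVec h n‖ < h * 4 ^ (k + 1))).card : ℝ) := by
        exact_mod_cast Finset.card_le_card hsub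
    _ ≤ (2 * (h * 4 ^ (k + 1)) / h + 1) ^ 3 := card_filter_norm_latticeVec_lt_le hh (by positivity) S
    _ = (8 * 4 ^ k + 1) ^ 3 := by congr 1; field_simp; ring
    _ ≤ (9 * 4 ^ k) ^ 3 := by
        have : (1 : ℝ) ≤ 4 ^ k := one_le_pow₀ (by norm_num)
        gcongr; linarith
    _ = 729 * 64 ^ k := by
        rw [show (64 : ℝ) = 4 ^ 3 by norm_num, ← pow_mul, mul_comm 3 k, pow_mul]; ring

/-- **`∑_{0 < |p| < R} |p|⁻¹ ≤ 778 R²/h³`** over any finite set of non-zero points `p = h·n` of the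
lattice `hℤ³` (`h > 0`, `R ≥ 0`). [folklore] -/
theorem latticeSum_inv_norm_le {h : ℝ} (hh : 0 < h) (R : ℝ) (S : Finset (Fin 3 → ℤ)) :
    ∑ n ∈ S.filter (fun n => n ≠ 0 ∧ ‖latticeVec h n‖ < R), 1 / ‖latticeVec h n‖ ≤
      778 * R ^ 2 / h ^ 3 := by
  set S' := S.filter (fun n => n ≠ 0 ∧ ‖latticeVec h n‖ < R) with hS'
  set kf : (Fin 3 → ℤ) → ℕ := fun n => Nat.log 4 ⌊‖latticeVec h n‖ / h⌋₊ with hkf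
  have hmaps : ∀ n ∈ S', kf n ∈ S'.image kf := fun n hn => Finset.mem_image_of_mem kf hn
  rw [← Finset.sum_fiberwise_of_maps_to hmaps]
  have hmem : ∀ n ∈ S', h ≤ ‖latticeVec h n‖ ∧ ‖latticeVec h n‖ < R := by
    intro n hn
    have hn' := (Finset.mem_filter.1 hn).2
    exact ⟨le_norm_latticeVec_of_ne_zero hh.le hn'.1, hn'.2⟩
  -- each shell
  have hshell : ∀ k ∈ S'.image kf,
      ∑ n ∈ S'.filter (fun n => kf n = k), 1 / ‖latticeVec h n‖ ≤ 729 / h * (16 : ℝ) ^ k := by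
    intro k _
    have hterm : ∀ n ∈ S'.filter (fun n => kf n = k), 1 / ‖latticeVec h n‖ ≤ 1 / (h * 4 ^ k) := by
      intro n hn
      rw [Finset.mem_filter] at hn
      have hb := (shell_bounds hh (hmem n hn.1).1).1
      rw [show Nat.log 4 ⌊‖latticeVec h n‖ / h⌋₊ = k from hn.2] at hb
      exact div_le_div_of_nonneg_left zero_le_one (by positivity) hb
    have hcard : ((S'.filter (fun n => kf n = k)).card : ℝ) ≤ 729 * 64 ^ k := by
      have hsub : S'.filter (fun n => kf n = k) ⊆
          S.filter (fun n => Nat.log 4 ⌊‖latticeVec h n‖ / h⌋₊ = k ∧ h ≤ ‖latticeVec h n‖) := by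
        intro n hn
        rw [Finset.mem_filter] at hn ⊢
        exact ⟨(Finset.mem_filter.1 hn.1).1, hn.2, (hmem n hn.1).1⟩
      calc ((S'.filter (fun n => kf n = k)).card : ℝ)
          ≤ ((S.filter (fun n => Nat.log 4 ⌊‖latticeVec h n‖ / h⌋₊ = k ∧ h ≤ ‖latticeVec h n‖)).card : ℝ) := by
            exact_mod_cast Finset.card_le_card hsub
        _ ≤ 729 * 64 ^ k := card_shell_le hh S k
    calc ∑ n ∈ S'.filter (fun n => kf n = k), 1 / ‖latticeVec h n‖
        ≤ (S'.filter (fun n => kf n = k)).card • (1 / (h * 4 ^ k)) := Finset.sum_le_card_nsmul _ _ _ hterm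
      _ = ((S'.filter (fun n => kf n = k)).card : ℝ) * (1 / (h * 4 ^ k)) := by rw [nsmul_eq_mul]
      _ ≤ 729 * 64 ^ k * (1 / (h * 4 ^ k)) := by gcongr
      _ = 729 / h * 16 ^ k := by
          rw [show (64 : ℝ) ^ k = 16 ^ k * 4 ^ k by rw [← mul_pow]; norm_num]
          field_simp
  -- the shell indices satisfy `4ᵏ ≤ R/h`
  have hT : ∀ k ∈ S'.image kf, (4 : ℝ) ^ k ≤ R / h := by
    intro k hk
    obtain ⟨n, hn, rfl⟩ := Finset.mem_image.1 hk
    have hb := (shell_bounds hh (hmem n hn).1).1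
    have hlt := (hmem n hn).2
    rw [le_div_iff₀ hh]
    nlinarith
  calc ∑ k ∈ S'.image kf, ∑ n ∈ S'.filter (fun n => kf n = k), 1 / ‖latticeVec h n‖
      ≤ ∑ k ∈ S'.image kf, 729 / h * (16 : ℝ) ^ k := Finset.sum_le_sum hshell
    _ = 729 / h * ∑ k ∈ S'.image kf, (16 : ℝ) ^ k := by rw [Finset.mul_sum]
    _ ≤ 729 / h * (16 / 15 * (R / h) ^ 2) := by
        gcongr
        exact sum_sixteen_pow_le hT
    _ ≤ 778 * R ^ 2 / h ^ 3 := by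
        rw [div_pow, show 729 / h * (16 / 15 * (R ^ 2 / h ^ 2)) = (729 * 16 / 15) * R ^ 2 / h ^ 3 by
          field_simp]
        gcongr
        norm_num

/-- **`∑_{0 < |p| < R} |p|⁻² ≤ 972 R/h³`** over any finite set of non-zero points of `hℤ³`
(`h > 0`, `R ≥ 0`). [folklore] -/
theorem latticeSum_inv_norm_sq_le {h : ℝ} (hh : 0 < h) {R : ℝ} (hR : 0 ≤ R) (S : Finset (Fin 3 → ℤ)) :
    ∑ n ∈ S.filter (fun n => n ≠ 0 ∧ ‖latticeVec h n‖ < R), 1 / ‖latticeVec h n‖ ^ 2 ≤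
      972 * R / h ^ 3 := by
  set S' := S.filter (fun n => n ≠ 0 ∧ ‖latticeVec h n‖ < R) with hS'
  set kf : (Fin 3 → ℤ) → ℕ := fun n => Nat.log 4 ⌊‖latticeVec h n‖ / h⌋₊ with hkf
  have hmaps : ∀ n ∈ S', kf n ∈ S'.image kf := fun n hn => Finset.mem_image_of_mem kf hn
  rw [← Finset.sum_fiberwise_of_maps_to hmaps]
  have hmem : ∀ n ∈ S', h ≤ ‖latticeVec h n‖ ∧ ‖latticeVec h n‖ < R := by
    intro n hn
    have hn' := (Finset.mem_filter.1 hn).2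
    exact ⟨le_norm_latticeVec_of_ne_zero hh.le hn'.1, hn'.2⟩
  have hshell : ∀ k ∈ S'.image kf,
      ∑ n ∈ S'.filter (fun n => kf n = k), 1 / ‖latticeVec h n‖ ^ 2 ≤ 729 / h ^ 2 * (4 : ℝ) ^ k := by
    intro k _
    have hterm : ∀ n ∈ S'.filter (fun n => kf n = k), 1 / ‖latticeVec h n‖ ^ 2 ≤ 1 / (h * 4 ^ k) ^ 2 := by
      intro n hn
      rw [Finset.mem_filter] at hn
      have hb := (shell_bounds hh (hmem n hn.1).1).1
      rw [show Nat.log 4 ⌊‖latticeVec h n‖ / h⌋₊ = k from hn.2] at hb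
      apply div_le_div_of_nonneg_left zero_le_one (by positivity)
      gcongr
    have hcard : ((S'.filter (fun n => kf n = k)).card : ℝ) ≤ 729 * 64 ^ k := by
      have hsub : S'.filter (fun n => kf n = k) ⊆
          S.filter (fun n => Nat.log 4 ⌊‖latticeVec h n‖ / h⌋₊ = k ∧ h ≤ ‖latticeVec h n‖) := by
        intro n hn
        rw [Finset.mem_filter] at hn ⊢
        exact ⟨(Finset.mem_filter.1 hn.1).1, hn.2, (hmem n hn.1).1⟩
      calc ((S'.filter (fun n => kf n = k)).card : ℝ)
          ≤ ((S.filter (fun n => Nat.log 4 ⌊‖latticeVec h n‖ / h⌋₊ = k ∧ h ≤ ‖latticeVec h n‖)).card : ℝ) := by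
            exact_mod_cast Finset.card_le_card hsub
        _ ≤ 729 * 64 ^ k := card_shell_le hh S k
    calc ∑ n ∈ S'.filter (fun n => kf n = k), 1 / ‖latticeVec h n‖ ^ 2
        ≤ (S'.filter (fun n => kf n = k)).card • (1 / (h * 4 ^ k) ^ 2) := Finset.sum_le_card_nsmul _ _ _ hterm
      _ = ((S'.filter (fun n => kf n = k)).card : ℝ) * (1 / (h * 4 ^ k) ^ 2) := by rw [nsmul_eq_mul]
      _ ≤ 729 * 64 ^ k * (1 / (h * 4 ^ k) ^ 2) := by gcongr
      _ = 729 / h ^ 2 * 4 ^ k := by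
          rw [show (64 : ℝ) ^ k = 4 ^ k * (4 ^ k) ^ 2 by
            rw [show ((4 : ℝ) ^ k) ^ 2 = 16 ^ k by rw [← pow_mul, mul_comm, pow_mul]; norm_num,
              ← mul_pow]; norm_num]
          field_simp
  have hT : ∀ k ∈ S'.image kf, (4 : ℝ) ^ k ≤ R / h := by
    intro k hk
    obtain ⟨n, hn, rfl⟩ := Finset.mem_image.1 hk
    have hb := (shell_bounds hh (hmem n hn).1).1
    have hlt := (hmem n hn).2
    rw [le_div_iff₀ hh]
    nlinarith
  calc ∑ k ∈ S'.image kf, ∑ n ∈ S'.filter (fun n => kf n = k), 1 / ‖latticeVec h n‖ ^ 2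
      ≤ ∑ k ∈ S'.image kf, 729 / h ^ 2 * (4 : ℝ) ^ k := Finset.sum_le_sum hshell
    _ = 729 / h ^ 2 * ∑ k ∈ S'.image kf, (4 : ℝ) ^ k := by rw [Finset.mul_sum]
    _ ≤ 729 / h ^ 2 * (4 / 3 * (R / h)) := by
        gcongr
        exact sum_four_pow_le (by positivity) hT
    _ = 972 * R / h ^ 3 := by field_simp; ring

/-- **`∑_{|p| ≥ R} |p|⁻⁴ ≤ 972/(R h³)`** over any finite set of points of `hℤ³` (`0 < h ≤ R`).
[folklore] -/
theorem latticeSum_inv_norm_pow_four_le {h R : ℝ} (hh : 0 < h) (hR : h ≤ R) (S : Finset (Fin 3 → ℤ)) :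
    ∑ n ∈ S.filter (fun n => R ≤ ‖latticeVec h n‖), 1 / ‖latticeVec h n‖ ^ 4 ≤ 972 / (R * h ^ 3) := by
  set c₀ := R / h with hc₀def
  have hc₀ : 1 ≤ c₀ := by rwa [hc₀def, le_div_iff₀ hh, one_mul]
  have hRc : R = c₀ * h := by rw [hc₀def]; field_simp
  have hR0 : 0 < R := lt_of_lt_of_le hh hR
  set S' := S.filter (fun n => R ≤ ‖latticeVec h n‖) with hS'
  set kf : (Fin 3 → ℤ) → ℕ := fun n => Nat.log 4 ⌊‖latticeVec h n‖ / R⌋₊ with hkf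
  have hmaps : ∀ n ∈ S', kf n ∈ S'.image kf := fun n hn => Finset.mem_image_of_mem kf hn
  rw [← Finset.sum_fiberwise_of_maps_to hmaps]
  have hshell : ∀ k ∈ S'.image kf,
      ∑ n ∈ S'.filter (fun n => kf n = k), 1 / ‖latticeVec h n‖ ^ 4 ≤
        729 * c₀ ^ 3 / R ^ 4 * ((1 : ℝ) / 4) ^ k := by
    intro k _
    have hterm : ∀ n ∈ S'.filter (fun n => kf n = k), 1 / ‖latticeVec h n‖ ^ 4 ≤ 1 / (R * 4 ^ k) ^ 4 := by
      intro n hn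
      rw [Finset.mem_filter] at hn
      have hnR : R ≤ ‖latticeVec h n‖ := (Finset.mem_filter.1 hn.1).2
      have hb := (shell_bounds hR0 hnR).1
      rw [show Nat.log 4 ⌊‖latticeVec h n‖ / R⌋₊ = k from hn.2] at hb
      apply div_le_div_of_nonneg_left zero_le_one (by positivity)
      gcongr
    have hcard : ((S'.filter (fun n => kf n = k)).card : ℝ) ≤ 729 * c₀ ^ 3 * 64 ^ k := by
      have hsub : S'.filter (fun n => kf n = k) ⊆ S.filter (fun n => ‖latticeVec h n‖ < R * 4 ^ (k + 1)) := by
        intro n hn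
        rw [Finset.mem_filter] at hn ⊢
        have hnS := Finset.mem_filter.1 hn.1
        have hb := (shell_bounds hR0 hnS.2).2
        rw [show Nat.log 4 ⌊‖latticeVec h n‖ / R⌋₊ = k from hn.2] at hb
        exact ⟨hnS.1, hb⟩
      calc ((S'.filter (fun n => kf n = k)).card : ℝ)
          ≤ ((S.filter (fun n => ‖latticeVec h n‖ < R * 4 ^ (k + 1))).card : ℝ) := by
            exact_mod_cast Finset.card_le_card hsub
        _ ≤ (2 * (R * 4 ^ (k + 1)) / h + 1) ^ 3 := card_filter_norm_latticeVec_lt_le hh (by positivity) S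
        _ = (8 * c₀ * 4 ^ k + 1) ^ 3 := by rw [hRc]; congr 1; field_simp; ring
        _ ≤ (9 * c₀ * 4 ^ k) ^ 3 := by
            have : (1 : ℝ) ≤ c₀ * 4 ^ k := by
              calc (1 : ℝ) = 1 * 1 := by norm_num
                _ ≤ c₀ * 4 ^ k := mul_le_mul hc₀ (one_le_pow₀ (by norm_num)) zero_le_one (by linarith)
            gcongr; linarith
        _ = 729 * c₀ ^ 3 * 64 ^ k := by
            rw [show (64 : ℝ) = 4 ^ 3 by norm_num, ← pow_mul, mul_comm 3 k, pow_mul]; ring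
    calc ∑ n ∈ S'.filter (fun n => kf n = k), 1 / ‖latticeVec h n‖ ^ 4
        ≤ (S'.filter (fun n => kf n = k)).card • (1 / (R * 4 ^ k) ^ 4) := Finset.sum_le_card_nsmul _ _ _ hterm
      _ = ((S'.filter (fun n => kf n = k)).card : ℝ) * (1 / (R * 4 ^ k) ^ 4) := by rw [nsmul_eq_mul]
      _ ≤ 729 * c₀ ^ 3 * 64 ^ k * (1 / (R * 4 ^ k) ^ 4) := by gcongr
      _ = 729 * c₀ ^ 3 / R ^ 4 * ((1 : ℝ) / 4) ^ k := by
          have h256 : ((R * 4 ^ k) ^ 4 : ℝ) = R ^ 4 * (64 ^ k * 4 ^ k) := by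
            rw [mul_pow]
            congr 1
            rw [← mul_pow, ← pow_mul, mul_comm k 4, pow_mul]
            norm_num
          rw [h256]
          field_simp
          rw [← mul_pow]; norm_num
  calc ∑ k ∈ S'.image kf, ∑ n ∈ S'.filter (fun n => kf n = k), 1 / ‖latticeVec h n‖ ^ 4
      ≤ ∑ k ∈ S'.image kf, 729 * c₀ ^ 3 / R ^ 4 * ((1 : ℝ) / 4) ^ k := Finset.sum_le_sum hshell
    _ = 729 * c₀ ^ 3 / R ^ 4 * ∑ k ∈ S'.image kf, ((1 : ℝ) / 4) ^ k := by rw [Finset.mul_sum]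
    _ ≤ 729 * c₀ ^ 3 / R ^ 4 * (4 / 3) := by
        gcongr
        exact sum_inv_four_pow_le _
    _ = 972 / (R * h ^ 3) := by
        rw [hc₀def]
        field_simp
        ring

/-- **`#{0 < |p| ≤ P} ≤ (2P/h + 3)³`** and hence `∑_{|p| ≤ P} 1`, `∑_{|p| ≤ P}|p|ᵐ ≤ Pᵐ(2P/h+3)³`.
[folklore] -/
theorem card_filter_norm_latticeVec_le_le {h : ℝ} (hh : 0 < h) {P : ℝ} (hP : 0 ≤ P)
    (S : Finset (Fin 3 → ℤ)) :
    ((S.filter fun n => ‖latticeVec h n‖ ≤ P).card : ℝ) ≤ (2 * P / h + 3) ^ 3 := by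
  have hsub : (S.filter fun n => ‖latticeVec h n‖ ≤ P) ⊆ S.filter fun n => ‖latticeVec h n‖ < P + h := by
    intro n hn
    rw [Finset.mem_filter] at hn ⊢
    exact ⟨hn.1, by linarith [hn.2]⟩
  calc ((S.filter fun n => ‖latticeVec h n‖ ≤ P).card : ℝ)
      ≤ ((S.filter fun n => ‖latticeVec h n‖ < P + h).card : ℝ) := by exact_mod_cast Finset.card_le_card hsub
    _ ≤ (2 * (P + h) / h + 1) ^ 3 := card_filter_norm_latticeVec_lt_le hh (by positivity) S
    _ = (2 * P / h + 3) ^ 3 := by congr 1; field_simp; ring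

/-! ### The norms of Lemma 2.2 for `σ_L`, `γ_L` over `P_L = {0 < |p| ≤ P}` -/

section Norms

variable {μ h : ℝ}

/-- **`‖σ‖² ≤ 520 μ^{3/2}/h³`**: for `0 < h ≤ √μ` and ANY finite set of non-zero lattice momenta
`p = h·n`, `∑ σ_p² ≤ 520 μ^{3/2} h⁻³` (`σ_p² = (p²+μ-s)/(2s)`, `s = √(p⁴+2μp²)`): split at `|p| = √μ`,
using `σ_p² ≤ √μ/(2√2|p|)` below and `σ_p² ≤ μ²/(4|p|⁴)` above. With `h = 2π`, `μ = 8π𝔞N^κ` this is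
`‖σ_L‖², ‖σ_S‖² ≤ CN^{3κ/2}` of Lemma 2.2. [cite: BastiCenatiempoSchlein2021, Lemma 2.2 and (2.14)–(2.15)] -/
theorem latticeSum_sigmaSq_le (hh : 0 < h) (hμ : 0 < μ) (hhμ : h ≤ Real.sqrt μ) (S : Finset (Fin 3 → ℤ)) :
    ∑ n ∈ S.filter (fun n => n ≠ 0),
        (‖latticeVec h n‖ ^ 2 + μ - Real.sqrt (‖latticeVec h n‖ ^ 4 + 2 * μ * ‖latticeVec h n‖ ^ 2)) /
          (2 * Real.sqrt (‖latticeVec h n‖ ^ 4 + 2 * μ * ‖latticeVec h n‖ ^ 2)) ≤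
      520 * (μ * Real.sqrt μ) / h ^ 3 := by
  obtain ⟨R, hRdef⟩ : ∃ R, Real.sqrt μ = R := ⟨_, rfl⟩
  have hR : 0 < R := hRdef ▸ Real.sqrt_pos.2 hμ
  have hR2 : R ^ 2 = μ := by rw [← hRdef, Real.sq_sqrt hμ.le]
  rw [hRdef] at hhμ ⊢
  have hs2 : 0 < Real.sqrt 2 := Real.sqrt_pos.2 (by norm_num)
  have h141 : (141 / 100 : ℝ) ≤ Real.sqrt 2 := by
    have := Real.sqrt_le_sqrt (show ((141 : ℝ) / 100) ^ 2 ≤ 2 by norm_num)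
    rwa [Real.sqrt_sq (by norm_num)] at this
  set S' := S.filter (fun n => n ≠ 0) with hS'
  rw [← Finset.sum_filter_add_sum_filter_not S' (fun n => ‖latticeVec h n‖ < R)]
  -- below `√μ`
  have hA : ∑ n ∈ S'.filter (fun n => ‖latticeVec h n‖ < R),
      (‖latticeVec h n‖ ^ 2 + μ - Real.sqrt (‖latticeVec h n‖ ^ 4 + 2 * μ * ‖latticeVec h n‖ ^ 2)) /
        (2 * Real.sqrt (‖latticeVec h n‖ ^ 4 + 2 * μ * ‖latticeVec h n‖ ^ 2)) ≤
      276 * (μ * R) / h ^ 3 := by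
    calc _ ≤ ∑ n ∈ S'.filter (fun n => ‖latticeVec h n‖ < R),
          R / (2 * Real.sqrt 2) * (1 / ‖latticeVec h n‖) := by
          refine Finset.sum_le_sum fun n hn => ?_
          have hn0 : n ≠ 0 := (Finset.mem_filter.1 (Finset.mem_filter.1 hn).1).2
          have hr : 0 < ‖latticeVec h n‖ := lt_of_lt_of_le hh (le_norm_latticeVec_of_ne_zero hh.le hn0)
          calc _ ≤ Real.sqrt μ / (2 * Real.sqrt 2 * ‖latticeVec h n‖) := sigmaSq_le_sqrt_div hμ hr
            _ = R / (2 * Real.sqrt 2) * (1 / ‖latticeVec h n‖) := by rw [hRdef]; field_simp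
      _ ≤ ∑ n ∈ S.filter (fun n => n ≠ 0 ∧ ‖latticeVec h n‖ < R),
          R / (2 * Real.sqrt 2) * (1 / ‖latticeVec h n‖) := by
          refine Finset.sum_le_sum_of_subset_of_nonneg ?_ (fun n _ _ => by positivity)
          intro n hn
          rw [Finset.mem_filter] at hn ⊢
          exact ⟨(Finset.mem_filter.1 hn.1).1, (Finset.mem_filter.1 hn.1).2, hn.2⟩
      _ = R / (2 * Real.sqrt 2) *
            ∑ n ∈ S.filter (fun n => n ≠ 0 ∧ ‖latticeVec h n‖ < R), 1 / ‖latticeVec h n‖ := by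
          rw [Finset.mul_sum]
      _ ≤ R / (2 * Real.sqrt 2) * (778 * R ^ 2 / h ^ 3) := by
          gcongr
          exact latticeSum_inv_norm_le hh R S
      _ = 778 / (2 * Real.sqrt 2) * (μ * R) / h ^ 3 := by rw [← hR2]; field_simp
      _ ≤ 276 * (μ * R) / h ^ 3 := by
          gcongr
          rw [div_le_iff₀ (by positivity)]
          linarith
  -- above `√μ`
  have hB : ∑ n ∈ S'.filter (fun n => ¬ ‖latticeVec h n‖ < R),
      (‖latticeVec h n‖ ^ 2 + μ - Real.sqrt (‖latticeVec h n‖ ^ 4 + 2 * μ * ‖latticeVec h n‖ ^ 2)) /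
        (2 * Real.sqrt (‖latticeVec h n‖ ^ 4 + 2 * μ * ‖latticeVec h n‖ ^ 2)) ≤
      243 * (μ * R) / h ^ 3 := by
    calc _ ≤ ∑ n ∈ S'.filter (fun n => ¬ ‖latticeVec h n‖ < R),
          μ ^ 2 / 4 * (1 / ‖latticeVec h n‖ ^ 4) := by
          refine Finset.sum_le_sum fun n hn => ?_
          have hn0 : n ≠ 0 := (Finset.mem_filter.1 (Finset.mem_filter.1 hn).1).2
          have hr : 0 < ‖latticeVec h n‖ := lt_of_lt_of_le hh (le_norm_latticeVec_of_ne_zero hh.le hn0)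
          calc _ ≤ μ ^ 2 / (4 * ‖latticeVec h n‖ ^ 4) := sigmaSq_le_sq_div_pow_four hμ.le hr
            _ = μ ^ 2 / 4 * (1 / ‖latticeVec h n‖ ^ 4) := by field_simp
      _ ≤ ∑ n ∈ S.filter (fun n => R ≤ ‖latticeVec h n‖), μ ^ 2 / 4 * (1 / ‖latticeVec h n‖ ^ 4) := by
          refine Finset.sum_le_sum_of_subset_of_nonneg ?_ (fun n _ _ => by positivity)
          intro n hn
          rw [Finset.mem_filter] at hn ⊢
          exact ⟨(Finset.mem_filter.1 hn.1).1, not_lt.1 hn.2⟩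
      _ = μ ^ 2 / 4 * ∑ n ∈ S.filter (fun n => R ≤ ‖latticeVec h n‖), 1 / ‖latticeVec h n‖ ^ 4 := by
          rw [Finset.mul_sum]
      _ ≤ μ ^ 2 / 4 * (972 / (R * h ^ 3)) := by
          gcongr
          exact latticeSum_inv_norm_pow_four_le hh hhμ S
      _ = 243 * (μ * R) / h ^ 3 := by
          rw [← hR2]
          field_simp
          ring
  have hpos : 0 ≤ μ * R / h ^ 3 := by positivity
  refine (add_le_add hA hB).trans ?_
  rw [← add_div, div_le_div_iff_of_pos_right (by positivity)]
  nlinarith [hR.le, hμ.le, mul_nonneg hμ.le hR.le]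

/-- **`‖γσ‖₁ ≤ (276 μ^{3/2} + 972 μP)/h³`**: for `0 < h ≤ √μ ≤ P` and any finite set of non-zero
lattice momenta with `|p| ≤ P`, `∑ μ/(2s) ≤ (276μ^{3/2} + 972μP)h⁻³` (`|γ_pσ_p| = μ/(2s)`): split at
`|p| = √μ`, using `μ/(2s) ≤ √μ/(2√2|p|)` below and `μ/(2s) ≤ μ/(2|p|²)` above. With `h = 2π`,
`μ = 8π𝔞N^κ`, `P = N^{κ/2+ε}` this is `‖γ_Lσ_L‖₁ ≤ CN^{3κ/2+ε}` of Lemma 2.2.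
[cite: BastiCenatiempoSchlein2021, Lemma 2.2 and (2.13)–(2.15)] -/
theorem latticeSum_gammaSigma_le (hh : 0 < h) (hμ : 0 < μ) (hhμ : h ≤ Real.sqrt μ) {P : ℝ}
    (hP : Real.sqrt μ ≤ P) (S : Finset (Fin 3 → ℤ)) :
    ∑ n ∈ S.filter (fun n => n ≠ 0 ∧ ‖latticeVec h n‖ ≤ P),
        μ / (2 * Real.sqrt (‖latticeVec h n‖ ^ 4 + 2 * μ * ‖latticeVec h n‖ ^ 2)) ≤
      (276 * (μ * Real.sqrt μ) + 972 * μ * P) / h ^ 3 := by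
  obtain ⟨R, hRdef⟩ : ∃ R, Real.sqrt μ = R := ⟨_, rfl⟩
  have hR : 0 < R := hRdef ▸ Real.sqrt_pos.2 hμ
  have hR2 : R ^ 2 = μ := by rw [← hRdef, Real.sq_sqrt hμ.le]
  rw [hRdef] at hhμ hP ⊢
  have hs2 : 0 < Real.sqrt 2 := Real.sqrt_pos.2 (by norm_num)
  have h141 : (141 / 100 : ℝ) ≤ Real.sqrt 2 := by
    have := Real.sqrt_le_sqrt (show ((141 : ℝ) / 100) ^ 2 ≤ 2 by norm_num)
    rwa [Real.sqrt_sq (by norm_num)] at this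
  have hhP : h ≤ P := hhμ.trans hP
  have hP0 : 0 ≤ P := hR.le.trans hP
  set S' := S.filter (fun n => n ≠ 0 ∧ ‖latticeVec h n‖ ≤ P) with hS'
  rw [← Finset.sum_filter_add_sum_filter_not S' (fun n => ‖latticeVec h n‖ < R)]
  -- below `√μ`
  have hA : ∑ n ∈ S'.filter (fun n => ‖latticeVec h n‖ < R),
      μ / (2 * Real.sqrt (‖latticeVec h n‖ ^ 4 + 2 * μ * ‖latticeVec h n‖ ^ 2)) ≤
      276 * (μ * R) / h ^ 3 := by
    calc _ ≤ ∑ n ∈ S'.filter (fun n => ‖latticeVec h n‖ < R),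
          R / (2 * Real.sqrt 2) * (1 / ‖latticeVec h n‖) := by
          refine Finset.sum_le_sum fun n hn => ?_
          have hn0 : n ≠ 0 := (Finset.mem_filter.1 (Finset.mem_filter.1 hn).1).2.1
          have hr : 0 < ‖latticeVec h n‖ := lt_of_lt_of_le hh (le_norm_latticeVec_of_ne_zero hh.le hn0)
          calc _ ≤ Real.sqrt μ / (2 * Real.sqrt 2 * ‖latticeVec h n‖) := gammaSigma_le_sqrt_div hμ hr
            _ = R / (2 * Real.sqrt 2) * (1 / ‖latticeVec h n‖) := by rw [hRdef]; field_simp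
      _ ≤ ∑ n ∈ S.filter (fun n => n ≠ 0 ∧ ‖latticeVec h n‖ < R),
          R / (2 * Real.sqrt 2) * (1 / ‖latticeVec h n‖) := by
          refine Finset.sum_le_sum_of_subset_of_nonneg ?_ (fun n _ _ => by positivity)
          intro n hn
          rw [Finset.mem_filter] at hn ⊢
          exact ⟨(Finset.mem_filter.1 hn.1).1, (Finset.mem_filter.1 hn.1).2.1, hn.2⟩
      _ = R / (2 * Real.sqrt 2) *
            ∑ n ∈ S.filter (fun n => n ≠ 0 ∧ ‖latticeVec h n‖ < R), 1 / ‖latticeVec h n‖ := by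
          rw [Finset.mul_sum]
      _ ≤ R / (2 * Real.sqrt 2) * (778 * R ^ 2 / h ^ 3) := by
          gcongr
          exact latticeSum_inv_norm_le hh R S
      _ = 778 / (2 * Real.sqrt 2) * (μ * R) / h ^ 3 := by rw [← hR2]; field_simp
      _ ≤ 276 * (μ * R) / h ^ 3 := by
          gcongr
          rw [div_le_iff₀ (by positivity)]
          linarith
  -- above `√μ`, up to `P`
  have hB : ∑ n ∈ S'.filter (fun n => ¬ ‖latticeVec h n‖ < R),
      μ / (2 * Real.sqrt (‖latticeVec h n‖ ^ 4 + 2 * μ * ‖latticeVec h n‖ ^ 2)) ≤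
      972 * μ * P / h ^ 3 := by
    calc _ ≤ ∑ n ∈ S'.filter (fun n => ¬ ‖latticeVec h n‖ < R), μ / 2 * (1 / ‖latticeVec h n‖ ^ 2) := by
          refine Finset.sum_le_sum fun n hn => ?_
          have hn0 : n ≠ 0 := (Finset.mem_filter.1 (Finset.mem_filter.1 hn).1).2.1
          have hr : 0 < ‖latticeVec h n‖ := lt_of_lt_of_le hh (le_norm_latticeVec_of_ne_zero hh.le hn0)
          calc _ ≤ μ / (2 * ‖latticeVec h n‖ ^ 2) := gammaSigma_le_div_sq hμ.le hr
            _ = μ / 2 * (1 / ‖latticeVec h n‖ ^ 2) := by field_simp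
      _ ≤ ∑ n ∈ S.filter (fun n => n ≠ 0 ∧ ‖latticeVec h n‖ < P + h), μ / 2 * (1 / ‖latticeVec h n‖ ^ 2) := by
          refine Finset.sum_le_sum_of_subset_of_nonneg ?_ (fun n _ _ => by positivity)
          intro n hn
          rw [Finset.mem_filter] at hn ⊢
          have h1 := Finset.mem_filter.1 hn.1
          exact ⟨h1.1, h1.2.1, by linarith [h1.2.2]⟩
      _ = μ / 2 * ∑ n ∈ S.filter (fun n => n ≠ 0 ∧ ‖latticeVec h n‖ < P + h), 1 / ‖latticeVec h n‖ ^ 2 := by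
          rw [Finset.mul_sum]
      _ ≤ μ / 2 * (972 * (P + h) / h ^ 3) := by
          gcongr
          exact latticeSum_inv_norm_sq_le hh (by linarith) S
      _ ≤ μ / 2 * (972 * (P + P) / h ^ 3) := by gcongr
      _ = 972 * μ * P / h ^ 3 := by field_simp; ring
  rw [add_div]
  linarith [hA, hB]

/-- **`‖σ‖²_{H¹} ≤ (10 μ^{5/2} + 486 μ²P)/h³`**: for `0 < h ≤ √μ ≤ P` and any finite set of non-zero
lattice momenta with `|p| ≤ P`, `∑ |p|²σ_p² ≤ (10μ^{5/2} + 486μ²P)h⁻³`: below `√μ` each of the at most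
`(3√μ/h)³` terms is `≤ μ/(2√2)`, above `|p|²σ_p² ≤ μ²/(4|p|²)`. With `h = 2π`, `μ = 8π𝔞N^κ`,
`P = N^{κ/2+ε}`: `‖σ_L‖²_{H¹}, ‖σ_S‖²_{H¹} ≤ CN^{5κ/2+ε}` of Lemma 2.2.
[cite: BastiCenatiempoSchlein2021, Lemma 2.2 and (2.14)–(2.16)] -/
theorem latticeSum_sq_mul_sigmaSq_le (hh : 0 < h) (hμ : 0 < μ) (hhμ : h ≤ Real.sqrt μ) {P : ℝ}
    (hP : Real.sqrt μ ≤ P) (S : Finset (Fin 3 → ℤ)) :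
    ∑ n ∈ S.filter (fun n => n ≠ 0 ∧ ‖latticeVec h n‖ ≤ P),
        ‖latticeVec h n‖ ^ 2 *
          ((‖latticeVec h n‖ ^ 2 + μ - Real.sqrt (‖latticeVec h n‖ ^ 4 + 2 * μ * ‖latticeVec h n‖ ^ 2)) /
            (2 * Real.sqrt (‖latticeVec h n‖ ^ 4 + 2 * μ * ‖latticeVec h n‖ ^ 2))) ≤
      (10 * (μ ^ 2 * Real.sqrt μ) + 486 * μ ^ 2 * P) / h ^ 3 := by
  obtain ⟨R, hRdef⟩ : ∃ R, Real.sqrt μ = R := ⟨_, rfl⟩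
  have hR : 0 < R := hRdef ▸ Real.sqrt_pos.2 hμ
  have hR2 : R ^ 2 = μ := by rw [← hRdef, Real.sq_sqrt hμ.le]
  rw [hRdef] at hhμ hP ⊢
  have hs2 : 0 < Real.sqrt 2 := Real.sqrt_pos.2 (by norm_num)
  have h141 : (141 / 100 : ℝ) ≤ Real.sqrt 2 := by
    have := Real.sqrt_le_sqrt (show ((141 : ℝ) / 100) ^ 2 ≤ 2 by norm_num)
    rwa [Real.sqrt_sq (by norm_num)] at this
  have hhP : h ≤ P := hhμ.trans hP
  have hP0 : 0 ≤ P := hR.le.trans hP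
  set S' := S.filter (fun n => n ≠ 0 ∧ ‖latticeVec h n‖ ≤ P) with hS'
  rw [← Finset.sum_filter_add_sum_filter_not S' (fun n => ‖latticeVec h n‖ < R)]
  -- below `√μ`: at most `(2R/h+1)³ ≤ (3R/h)³` terms, each `≤ R²·√μ/(2√2R) = μ/(2√2)`
  have hA : ∑ n ∈ S'.filter (fun n => ‖latticeVec h n‖ < R),
      ‖latticeVec h n‖ ^ 2 *
        ((‖latticeVec h n‖ ^ 2 + μ - Real.sqrt (‖latticeVec h n‖ ^ 4 + 2 * μ * ‖latticeVec h n‖ ^ 2)) /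
          (2 * Real.sqrt (‖latticeVec h n‖ ^ 4 + 2 * μ * ‖latticeVec h n‖ ^ 2))) ≤
      10 * (μ ^ 2 * R) / h ^ 3 := by
    have hterm : ∀ n ∈ S'.filter (fun n => ‖latticeVec h n‖ < R),
        ‖latticeVec h n‖ ^ 2 *
          ((‖latticeVec h n‖ ^ 2 + μ - Real.sqrt (‖latticeVec h n‖ ^ 4 + 2 * μ * ‖latticeVec h n‖ ^ 2)) /
            (2 * Real.sqrt (‖latticeVec h n‖ ^ 4 + 2 * μ * ‖latticeVec h n‖ ^ 2))) ≤
        R * R / (2 * Real.sqrt 2) := by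
      intro n hn
      rw [Finset.mem_filter] at hn
      have hn0 : n ≠ 0 := (Finset.mem_filter.1 hn.1).2.1
      have hr : 0 < ‖latticeVec h n‖ := lt_of_lt_of_le hh (le_norm_latticeVec_of_ne_zero hh.le hn0)
      have hσ := sigmaSq_le_sqrt_div hμ hr
      rw [hRdef] at hσ
      calc _ ≤ ‖latticeVec h n‖ ^ 2 * (R / (2 * Real.sqrt 2 * ‖latticeVec h n‖)) := by
            gcongr
        _ = ‖latticeVec h n‖ * R / (2 * Real.sqrt 2) := by field_simp
        _ ≤ R * R / (2 * Real.sqrt 2) := by gcongr; exact hn.2.le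
    have hcard : ((S'.filter (fun n => ‖latticeVec h n‖ < R)).card : ℝ) ≤ 27 * R ^ 3 / h ^ 3 := by
      have hsub : S'.filter (fun n => ‖latticeVec h n‖ < R) ⊆ S.filter (fun n => ‖latticeVec h n‖ < R) := by
        intro n hn
        rw [Finset.mem_filter] at hn ⊢
        exact ⟨(Finset.mem_filter.1 hn.1).1, hn.2⟩
      calc ((S'.filter (fun n => ‖latticeVec h n‖ < R)).card : ℝ)
          ≤ ((S.filter (fun n => ‖latticeVec h n‖ < R)).card : ℝ) := by exact_mod_cast Finset.card_le_card hsub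
        _ ≤ (2 * R / h + 1) ^ 3 := card_filter_norm_latticeVec_lt_le hh hR.le S
        _ ≤ (3 * R / h) ^ 3 := by
            gcongr
            rw [div_add_one hh.ne', div_le_div_iff_of_pos_right hh]
            linarith
        _ = 27 * R ^ 3 / h ^ 3 := by rw [div_pow]; ring
    calc _ ≤ (S'.filter (fun n => ‖latticeVec h n‖ < R)).card • (R * R / (2 * Real.sqrt 2)) :=
          Finset.sum_le_card_nsmul _ _ _ hterm
      _ = ((S'.filter (fun n => ‖latticeVec h n‖ < R)).card : ℝ) * (R * R / (2 * Real.sqrt 2)) := by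
          rw [nsmul_eq_mul]
      _ ≤ 27 * R ^ 3 / h ^ 3 * (R * R / (2 * Real.sqrt 2)) := by gcongr
      _ = 27 / (2 * Real.sqrt 2) * (μ ^ 2 * R) / h ^ 3 := by
          rw [← hR2]
          field_simp
      _ ≤ 10 * (μ ^ 2 * R) / h ^ 3 := by
          gcongr
          rw [div_le_iff₀ (by positivity)]
          linarith
  -- above `√μ`, up to `P`
  have hB : ∑ n ∈ S'.filter (fun n => ¬ ‖latticeVec h n‖ < R),
      ‖latticeVec h n‖ ^ 2 *
        ((‖latticeVec h n‖ ^ 2 + μ - Real.sqrt (‖latticeVec h n‖ ^ 4 + 2 * μ * ‖latticeVec h n‖ ^ 2)) /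
          (2 * Real.sqrt (‖latticeVec h n‖ ^ 4 + 2 * μ * ‖latticeVec h n‖ ^ 2))) ≤
      486 * μ ^ 2 * P / h ^ 3 := by
    calc _ ≤ ∑ n ∈ S'.filter (fun n => ¬ ‖latticeVec h n‖ < R), μ ^ 2 / 4 * (1 / ‖latticeVec h n‖ ^ 2) := by
          refine Finset.sum_le_sum fun n hn => ?_
          have hn0 : n ≠ 0 := (Finset.mem_filter.1 (Finset.mem_filter.1 hn).1).2.1
          have hr : 0 < ‖latticeVec h n‖ := lt_of_lt_of_le hh (le_norm_latticeVec_of_ne_zero hh.le hn0)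
          have hσ := sigmaSq_le_sq_div_pow_four hμ.le hr
          calc _ ≤ ‖latticeVec h n‖ ^ 2 * (μ ^ 2 / (4 * ‖latticeVec h n‖ ^ 4)) := by gcongr
            _ = μ ^ 2 / 4 * (1 / ‖latticeVec h n‖ ^ 2) := by field_simp
      _ ≤ ∑ n ∈ S.filter (fun n => n ≠ 0 ∧ ‖latticeVec h n‖ < P + h), μ ^ 2 / 4 * (1 / ‖latticeVec h n‖ ^ 2) := by
          refine Finset.sum_le_sum_of_subset_of_nonneg ?_ (fun n _ _ => by positivity)
          intro n hn
          rw [Finset.mem_filter] at hn ⊢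
          have h1 := Finset.mem_filter.1 hn.1
          exact ⟨h1.1, h1.2.1, by linarith [h1.2.2]⟩
      _ = μ ^ 2 / 4 * ∑ n ∈ S.filter (fun n => n ≠ 0 ∧ ‖latticeVec h n‖ < P + h), 1 / ‖latticeVec h n‖ ^ 2 := by
          rw [Finset.mul_sum]
      _ ≤ μ ^ 2 / 4 * (972 * (P + h) / h ^ 3) := by
          gcongr
          exact latticeSum_inv_norm_sq_le hh (by linarith) S
      _ ≤ μ ^ 2 / 4 * (972 * (P + P) / h ^ 3) := by gcongr
      _ = 486 * μ ^ 2 * P / h ^ 3 := by field_simp; ring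
  rw [add_div]
  linarith [hA, hB]

/-- **`‖γ‖² = ∑(1 + σ_p²) ≤ (2P/h + 3)³ + 520μ^{3/2}/h³`** over the non-zero lattice momenta with
`|p| ≤ P` (`0 < h ≤ √μ`). With `h = 2π`, `μ = 8π𝔞N^κ`, `P = N^{κ/2+ε}`: `‖γ_L‖² ≤ CN^{3κ/2+3ε}` of
Lemma 2.2. [cite: BastiCenatiempoSchlein2021, Lemma 2.2] -/
theorem latticeSum_one_add_sigmaSq_le (hh : 0 < h) (hμ : 0 < μ) (hhμ : h ≤ Real.sqrt μ) {P : ℝ}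
    (hP : 0 ≤ P) (S : Finset (Fin 3 → ℤ)) :
    ∑ n ∈ S.filter (fun n => n ≠ 0 ∧ ‖latticeVec h n‖ ≤ P),
        (1 + (‖latticeVec h n‖ ^ 2 + μ - Real.sqrt (‖latticeVec h n‖ ^ 4 + 2 * μ * ‖latticeVec h n‖ ^ 2)) /
          (2 * Real.sqrt (‖latticeVec h n‖ ^ 4 + 2 * μ * ‖latticeVec h n‖ ^ 2))) ≤
      (2 * P / h + 3) ^ 3 + 520 * (μ * Real.sqrt μ) / h ^ 3 := by
  rw [Finset.sum_add_distrib, Finset.sum_const, nsmul_eq_mul, mul_one]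
  have h1 : (((S.filter (fun n => n ≠ 0 ∧ ‖latticeVec h n‖ ≤ P))).card : ℝ) ≤ (2 * P / h + 3) ^ 3 := by
    calc (((S.filter (fun n => n ≠ 0 ∧ ‖latticeVec h n‖ ≤ P))).card : ℝ)
        ≤ ((S.filter (fun n => ‖latticeVec h n‖ ≤ P)).card : ℝ) := by
          exact_mod_cast Finset.card_le_card (fun n hn => by
            rw [Finset.mem_filter] at hn ⊢; exact ⟨hn.1, hn.2.2⟩)
      _ ≤ (2 * P / h + 3) ^ 3 := card_filter_norm_latticeVec_le_le hh hP S
  have h2 : ∑ n ∈ S.filter (fun n => n ≠ 0 ∧ ‖latticeVec h n‖ ≤ P),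
      (‖latticeVec h n‖ ^ 2 + μ - Real.sqrt (‖latticeVec h n‖ ^ 4 + 2 * μ * ‖latticeVec h n‖ ^ 2)) /
        (2 * Real.sqrt (‖latticeVec h n‖ ^ 4 + 2 * μ * ‖latticeVec h n‖ ^ 2)) ≤
      520 * (μ * Real.sqrt μ) / h ^ 3 := by
    calc _ ≤ ∑ n ∈ S.filter (fun n => n ≠ 0),
          (‖latticeVec h n‖ ^ 2 + μ - Real.sqrt (‖latticeVec h n‖ ^ 4 + 2 * μ * ‖latticeVec h n‖ ^ 2)) /
            (2 * Real.sqrt (‖latticeVec h n‖ ^ 4 + 2 * μ * ‖latticeVec h n‖ ^ 2)) := by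
          refine Finset.sum_le_sum_of_subset_of_nonneg ?_ (fun n hn _ => ?_)
          · intro n hn
            rw [Finset.mem_filter] at hn ⊢
            exact ⟨hn.1, hn.2.1⟩
          · have hn0 : n ≠ 0 := (Finset.mem_filter.1 hn).2
            have hr : 0 < ‖latticeVec h n‖ := lt_of_lt_of_le hh (le_norm_latticeVec_of_ne_zero hh.le hn0)
            exact sigmaSq_nonneg hμ.le hr
      _ ≤ 520 * (μ * Real.sqrt μ) / h ^ 3 := latticeSum_sigmaSq_le hh hμ hhμ S
  linarith [h1, h2]

/-- **Sup bounds (`‖σ_L‖²_∞ ≤ CN^{κ/2}`, `‖σ_S‖²_∞, ‖γ_S‖²_∞ - 1 ≤ CN^ε`).** For a non-zero lattice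
momentum with `|p| ≥ R₁ > 0`: `σ_p² ≤ √μ/(2√2R₁)` and `|γ_pσ_p| ≤ √μ/(2√2R₁)`; in particular
(`R₁ = h`) `σ_p² ≤ √μ/(2√2h)` for every `p ∈ hℤ³ ∖ 0`. [cite: BastiCenatiempoSchlein2021, Lemma 2.2 and (2.14)] -/
theorem sigmaSq_latticeVec_le_of_le {R₁ : ℝ} (hμ : 0 < μ) (hR₁ : 0 < R₁) {n : Fin 3 → ℤ}
    (hn : R₁ ≤ ‖latticeVec h n‖) :
    (‖latticeVec h n‖ ^ 2 + μ - Real.sqrt (‖latticeVec h n‖ ^ 4 + 2 * μ * ‖latticeVec h n‖ ^ 2)) /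
          (2 * Real.sqrt (‖latticeVec h n‖ ^ 4 + 2 * μ * ‖latticeVec h n‖ ^ 2)) ≤
        Real.sqrt μ / (2 * Real.sqrt 2 * R₁) ∧
      μ / (2 * Real.sqrt (‖latticeVec h n‖ ^ 4 + 2 * μ * ‖latticeVec h n‖ ^ 2)) ≤
        Real.sqrt μ / (2 * Real.sqrt 2 * R₁) := by
  have hr : 0 < ‖latticeVec h n‖ := lt_of_lt_of_le hR₁ hn
  have hs2 : 0 < Real.sqrt 2 := Real.sqrt_pos.2 (by norm_num)
  have hmono : Real.sqrt μ / (2 * Real.sqrt 2 * ‖latticeVec h n‖) ≤ Real.sqrt μ / (2 * Real.sqrt 2 * R₁) := by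
    apply div_le_div_of_nonneg_left (Real.sqrt_nonneg μ) (by positivity)
    gcongr
  exact ⟨(sigmaSq_le_sqrt_div hμ hr).trans hmono, (gammaSigma_le_sqrt_div hμ hr).trans hmono⟩

end Norms

end Literature.MathematicalPhysics.QuantumManyBody.BoseGas

end
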